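import Summits.Langlands.Langlands.Statement
import Literature.NumberTheory.Automorphic.GL2RSLFactorUnramified
import Literature.NumberTheory.Automorphic.GL2UnramifiedLFactorDivisibility
import Literature.NumberTheory.Automorphic.ShintaniWhittakerFormula
import HarnessLib

/-!
# Line `Sketch` for the crux `ReciprocityUpToIrreducibility` (item stmt-Langlands-14328), continuation c6:
# stub S2 — torus bookkeeping for the spherical Whittaker function on the `GL₁`-corner of `GL_n`

Support file (closes nothing; continuation lead c6, stub S2 `stub_spherical_whittaker_corner`).

Let `F` be a non-archimedean local field, `1 < n`, `π` a representation of `GL_n(F)` on `V`,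
`ψ` an additive character of conductor `𝒪` (`ψ.HasConductorExp 0`), `Λ` a `ψ`-Whittaker
functional and `v ∈ V` fixed by `GL_n(𝒪) = glInt n F`.  For the Whittaker function
`W_v(g) = Λ(π(g) v) = whittakerModel π Λ v g` on the corner torus
`d(a) = glCorner F _ (glDiagonal 1 F a) = diag(a, 1, …, 1)` we prove:

* `glCorner_glDiagonal_fin_one_eq_diagonalGL` — `diag(a, 1_{n-1}) = diagonalGL (a, 1, …, 1)`;
* `glCorner_glDiagonal_fin_one_mem_glInt` — `d(u) ∈ GL_n(𝒪)` for `|u| = 1`;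
* `whittakerModel_transvectionGL_glCorner` — `W_{π(1 + x E₁₂) v}(d(a)) = ψ(a x) W_v(d(a))`
  (`d(a) (1 + x E₁₂) d(a)⁻¹ = 1 + a x E₁₂ ∈ U_n` has generic character `ψ(a x)`);
* `stub_spherical_whittaker_corner` — (1) **vanishing beyond the conductor**: `W_v(d(a)) = 0` for
  `|a| > 1` (pick `x ∈ 𝒪` with `ψ(a x) ≠ 1`; `1 + x E₁₂ ∈ GL_n(𝒪)` fixes `v`, so
  `W_v(d(a)) = ψ(a x) W_v(d(a))`), and (2) **`𝒪ˣ`-invariance**: `W_v(d(t u)) = W_v(d(t))` for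
  `|u| = 1` (`d(t u) = d(t) d(u)` with `d(u) ∈ GL_n(𝒪)`).

This is the rank-`n` form of `whittakerModel_diagGL2_eq_zero_of_one_lt` and
`whittakerModel_diagGL2_mul_of_valuation_eq_one` (`GL2RSLFactorUnramified`, `n = 2`).
(Jacquet–Piatetski-Shapiro–Shalika 1983, §2.4 with `m = 1`; Shintani 1976; Cogdell 2004, §6.1 and
Thm. 3.3.)  No definitions; std axioms.
-/

open scoped MatrixGroups Matrix NumberField Classical Polynomial NNReal
open Filter IsDedekindDomain Field Polynomial MeasureTheory Literature.NumberTheory.Automorphic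
  Literature.NumberTheory.GaloisRepresentations Literature.NumberTheory.PAdicHodge Summit.Langlands

noncomputable section
set_option linter.dupNamespace false -- project-wide option (lakefile weak.linter.dupNamespace); `Summit.Langlands.Langlands` is the mandated namespace

namespace Summit.Langlands.Langlands.Theorems.ReciprocityUpToIrreducibility

/-- **The `GL₁`-corner of `GL_n` is a diagonal torus element**:
`glCorner F h (glDiagonal 1 F a) = diag(a, 1, …, 1) = diagonalGL (i ↦ if i = 0 then a else 1)`.
[folklore] -/
theorem glCorner_glDiagonal_fin_one_eq_diagonalGL {F : Type*} [Field F] {n : ℕ} (h : 1 ≤ n)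
    (a : Fˣ) :
    glCorner F h (glDiagonal 1 F fun _ => a) =
      diagonalGL (Fin n) F fun i => if (i : ℕ) = 0 then a else 1 := by
  refine Matrix.GeneralLinearGroup.ext fun i j => ?_
  obtain ⟨x, rfl⟩ := (finBlockEquiv h).surjective i
  obtain ⟨y, rfl⟩ := (finBlockEquiv h).surjective j
  rw [coe_diagonalGL]
  rcases x with a' | b <;> rcases y with a'' | b'
  · obtain rfl : a' = a'' := Subsingleton.elim _ _
    rw [glCorner_apply_inl_inl, coe_glDiagonal, Matrix.diagonal_apply_eq, Matrix.diagonal_apply_eq,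
      coe_finBlockEquiv_inl, if_pos (Fin.fin_one_eq_zero a' ▸ rfl)]
  · rw [glCorner_apply_inl_inr, Matrix.diagonal_apply_ne]
    exact fun hxy => Sum.inl_ne_inr ((finBlockEquiv h).injective hxy)
  · rw [glCorner_apply_inr_inl, Matrix.diagonal_apply_ne]
    exact fun hxy => Sum.inr_ne_inl ((finBlockEquiv h).injective hxy)
  · by_cases hbb : b = b'
    · subst hbb
      rw [glCorner_apply_inr_inr, Matrix.one_apply_eq, Matrix.diagonal_apply_eq,
        coe_finBlockEquiv_inr, if_neg (by omega), Units.val_one]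
    · rw [glCorner_apply_inr_inr, Matrix.one_apply_ne hbb, Matrix.diagonal_apply_ne]
      exact fun hxy => hbb (Sum.inr_injective ((finBlockEquiv h).injective hxy))

/-- **`diag(u, 1_{n-1}) ∈ GL_n(𝒪)` for a unit `u` of valuation `1`** (rank-`n` form of
`glDiagonal_fin_one_mem_glInt`, `diagGL2_mem_glInt`). [folklore] -/
theorem glCorner_glDiagonal_fin_one_mem_glInt {F : Type*} [Field F] [ValuativeRel F] {n : ℕ}
    (h : 1 ≤ n) {u : Fˣ} (hu : ValuativeRel.valuation F (u : F) = 1) :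
    glCorner F h (glDiagonal 1 F fun _ => u) ∈ glInt n F := by
  rw [glCorner_glDiagonal_fin_one_eq_diagonalGL]
  refine diagonalGL_mem_glInt fun i => ?_
  split_ifs
  · exact hu
  · rw [Units.val_one, map_one]

/-- **Right translation of the corner Whittaker value by an elementary unipotent**: for a
`ψ`-Whittaker functional `Λ`, `W_{π(1 + x E₁₂) v}(d(a)) = ψ(a x) W_v(d(a))` on
`d(a) = diag(a, 1_{n-1})`, since `d(a) (1 + x E₁₂) = (1 + a x E₁₂) d(a)` and
`ψ_U(1 + a x E₁₂) = ψ(a x)` (rank-`n` form of `whittakerModel_unipotentGL2_diagGL2`). [folklore] -/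
theorem whittakerModel_transvectionGL_glCorner {F : Type*} [Field F] {n : ℕ} (hn : 1 < n)
    {V : Type*} [AddCommGroup V] [Module ℂ V] (π : Representation ℂ (GL (Fin n) F) V)
    {ψ : AddChar F Circle} {Λ : Module.Dual ℂ V} (hΛ : Λ ∈ whittakerFunctionals π ψ) (v : V)
    (a : Fˣ) (x : F) (h01 : (⟨0, Nat.zero_lt_of_lt hn⟩ : Fin n) ≠ ⟨1, hn⟩) :
    whittakerModel π Λ (π (transvectionGL (⟨0, Nat.zero_lt_of_lt hn⟩ : Fin n) ⟨1, hn⟩ h01 x) v)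
        (glCorner F hn.le (glDiagonal 1 F fun _ => a)) =
      ψ ((a : F) * x) * whittakerModel π Λ v (glCorner F hn.le (glDiagonal 1 F fun _ => a)) := by
  rw [← whittakerModel_apply_apply_mul, glCorner_glDiagonal_fin_one_eq_diagonalGL]
  set d : Fin n → Fˣ := fun i => if (i : ℕ) = 0 then a else 1 with hd
  have hlt : (⟨0, Nat.zero_lt_of_lt hn⟩ : Fin n) < ⟨1, hn⟩ := Fin.mk_lt_mk.2 Nat.zero_lt_one
  have hU : diagonalGL (Fin n) F d * transvectionGL _ _ h01 x * (diagonalGL (Fin n) F d)⁻¹ ∈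
      upperUnitriangular (Fin n) F :=
    diagonalGL_conj_mem_upperUnitriangular d (transvectionGL_mem_upperUnitriangular hlt x)
  have hfac : diagonalGL (Fin n) F d * transvectionGL _ _ h01 x =
      ((⟨_, hU⟩ : ↥(upperUnitriangular (Fin n) F)) : GL (Fin n) F) * diagonalGL (Fin n) F d := by
    rw [inv_mul_cancel_right]
  rw [hfac, whittakerModel_apply, whittakerModel_apply, map_mul, Module.End.mul_apply,
    (mem_whittakerFunctionals_iff Λ).1 hΛ, whittakerCharFun_apply,
    superdiagSum_conj_transvectionGL d
      (show (((⟨0, Nat.zero_lt_of_lt hn⟩ : Fin n) : ℕ) + 1 = ((⟨1, hn⟩ : Fin n) : ℕ)) from rfl) x]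
  have hd0 : d ⟨0, Nat.zero_lt_of_lt hn⟩ = a := if_pos rfl
  have hd1 : d ⟨1, hn⟩ = 1 := if_neg Nat.one_ne_zero
  rw [hd0, hd1, inv_one, Units.val_one, mul_one]

/-- **stub S2 (torus bookkeeping for the spherical Whittaker function on the corner).**  For `ψ` of
conductor `𝒪`, `Λ` a `ψ`-Whittaker functional and `v` fixed by `GL_n(𝒪)`, the Whittaker function
`W_v = whittakerModel π Λ v` on the corner torus `d(a) = diag(a, 1_{n-1})` satisfies
(1) `W_v(d(a)) = 0` for `|a| > 1` — for `x ∈ 𝒪` the unipotent `1 + x E₁₂ ∈ GL_n(𝒪)` fixes `v`, so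
`W_v(d(a)) = W_{π(1 + x E₁₂) v}(d(a)) = ψ(a x) W_v(d(a))`, and `ψ(a 𝒪) ≠ 1`
(`exists_mem_primePowBall_addChar_mul_ne_one`); (2) `W_v(d(t u)) = W_v(d(t))` for `|u| = 1` —
`d(t u) = d(t) d(u)` with `d(u) ∈ GL_n(𝒪)`.  Rank-`n` form of
`whittakerModel_diagGL2_eq_zero_of_one_lt` / `whittakerModel_diagGL2_mul_of_valuation_eq_one`.
(Jacquet–Piatetski-Shapiro–Shalika 1983, §2.4 (`m = 1`); Shintani 1976; Jacquet–Langlands 1970,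
proof of Prop. 3.5 (`n = 2`).) [cite: JacquetPiatetskiShapiroShalika1983, §2.4]
[cite: CogdellAnalyticTheory2004, §6.1] -/
theorem stub_spherical_whittaker_corner :
    ∀ (F : Type) [Field F] [ValuativeRel F] [TopologicalSpace F] [IsNonarchimedeanLocalField F]
      (n : ℕ) (hn : 1 < n) (V : Type) [AddCommGroup V] [Module ℂ V]
      (π : Representation ℂ (GL (Fin n) F) V) (ψ : AddChar F Circle), ψ.HasConductorExp 0 →
      ∀ (Λ : Module.Dual ℂ V), Λ ∈ whittakerFunctionals π ψ →
      ∀ (v : V), v ∈ π.fixedPoints (glInt n F) →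
        (∀ a : Fˣ, 1 < IsNonarchimedeanLocalField.normAbs F (a : F) →
          whittakerModel π Λ v (glCorner F hn.le (glDiagonal 1 F fun _ => a)) = 0) ∧
        (∀ (t u : Fˣ), ValuativeRel.valuation F (u : F) = 1 →
          whittakerModel π Λ v (glCorner F hn.le (glDiagonal 1 F fun _ => t * u)) =
            whittakerModel π Λ v (glCorner F hn.le (glDiagonal 1 F fun _ => t))) := by
  -- adapted from `whittakerModel_diagGL2_eq_zero_of_one_lt` and
  -- `whittakerModel_diagGL2_mul_of_valuation_eq_one` (`GL2RSLFactorUnramified`, `n = 2`)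
  intro F _ _ _ _ n hn V _ _ π ψ hψ Λ hΛ v hv
  refine ⟨fun a ha => ?_, fun t u hu => ?_⟩
  · have ha' : (a : F) ∉ primePowBall F (0 - 0) := by
      rw [sub_zero, mem_primePowBall_iff, zpow_zero]
      exact not_le.2 ha
    obtain ⟨x₀, hx₀, hne⟩ := exists_mem_primePowBall_addChar_mul_ne_one hψ ha'
    have hx₀O : x₀ ∈ (ValuativeRel.valuation F).integer := by
      rw [mem_primePowBall_iff, zpow_zero, IsNonarchimedeanLocalField.normAbs_le_one_iff] at hx₀
      exact hx₀
    have h01 : (⟨0, Nat.zero_lt_of_lt hn⟩ : Fin n) ≠ ⟨1, hn⟩ :=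
      Fin.ne_of_lt (Fin.mk_lt_mk.2 Nat.zero_lt_one)
    have hfix : π (transvectionGL (⟨0, Nat.zero_lt_of_lt hn⟩ : Fin n) ⟨1, hn⟩ h01 x₀) v = v :=
      (π.mem_fixedPoints _ v).1 hv _ (transvectionGL_mem_glInt h01 hx₀O)
    have h := whittakerModel_transvectionGL_glCorner hn π hΛ v a x₀ h01
    rw [hfix] at h
    have h' : (1 - (ψ ((a : F) * x₀) : ℂ)) *
        whittakerModel π Λ v (glCorner F hn.le (glDiagonal 1 F fun _ => a)) = 0 := by
      rw [sub_mul, one_mul, ← h, sub_self]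
    rcases mul_eq_zero.1 h' with h1 | h1
    · exfalso
      apply hne
      rw [mul_comm]
      exact Circle.coe_eq_one.1 (sub_eq_zero.1 h1).symm
    · exact h1
  · have hmul : (fun _ : Fin 1 => t * u) = (fun _ => t) * (fun _ => u) := rfl
    rw [hmul, map_mul, map_mul, whittakerModel_apply_apply_mul,
      (π.mem_fixedPoints _ v).1 hv _ (glCorner_glDiagonal_fin_one_mem_glInt hn.le hu)]

end Summit.Langlands.Langlands.Theorems.ReciprocityUpToIrreducibility
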